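/- COR-CM (cell pub-hodgecm2) — Δ2 BRIDGE, ORIENTATION AUDIT, TEST T2 (ORIENTATION-MEMO v1.3 §4), wall-breaker wb-9
(prover-pub-hodgecm2-d2bridge-wb-9-g0-0), TRANSPORT route.  THEOREMS ONLY; nothing landed is edited or restated; no named fact,
no `sorry`.  FRAMING: HC_CM is NOT proved; «Δ2 BRIDGE CLOSED» is NOT claimed. -/
import Summits.HodgeConjecture.HodgeCM.Model.LiuDictionaryTower
import Summits.HodgeConjecture.HodgeCM.Model.TowerFixed
import Summits.HodgeConjecture.HodgeCM.Model.LiuDictionaryPin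
import Literature.AlgebraicGeometry.HodgeTheory.BettiUniverseCMTypes
import HarnessLib

/-!
# Δ2 bridge, orientation test T2: a `PhiMu` block constrained by `Thm418C` into `(1,0)`-classes and read in `(0,1)` vanishes

ORIENTATION-MEMO v1.3 §3.1 (E) ∕ §4 (T2), in the kernel.  For a real-carrier dictionary `T : LiuDictionary hHD hI h₁ h₃ V` and a
character `μ` with `T.PhiMu μ`:
* §1–§2 `res_eq_zero_of_thm418C_of_disjoint` ∕ `…_of_hodgeTypes` — `T.Thm418C` (r8: below a threshold every `K`-fixed vector of
  `block μ` restricts into `span (cmClasses K μ)`) + (T1) CM classes in `H^{1,0}(P_K)` + (D) the block restricts into `H^{0,1}(P_K)`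
  ⇒ below a threshold every `K`-fixed vector of `block μ` restricts to `0` (`H^{1,0} ∩ H^{0,1} = 0`, `BettiUniverse.disjoint_hodge_piece`).
* §3 `submodule_tower_eq_bot_of_res_eq_zero` — TOWER SEPARATION: a `U(V)(𝔸_f)`-stable `ℂ`-subspace of `H = colim_K H¹(X_K(ℂ); ℂ)`
  whose vectors from levels `Γ ≤ Γ₀` restrict to `0` on the identity component `P_Γ` is `⊥` (binder-1's API: `exists_ofLevel`,
  `act_ofLevel` ∕ `translate_apply`, `res_apply`, `trPull_one_injective`).
* §4–§5 `block_ofTower_eq_bot_of_thm418C_of_hodgeTypes` ∕ `block_pin_eq_bot_of_thm418C_of_hodgeTypes` — at every tower-built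
  dictionary, in particular THE PINNED DICTIONARY `liuDictionaryPin … V I line` of the END: `Thm418C` + (T1) + (D) ⇒ `block i = ⊥` at
  every `PhiMu` line; with a non-zero block the three are contradictory (`false_of_…`).
* §4b `not_block_res_subset_piece_zero_one_of_res_mem_F_one` (∕ `…_pin_…`) — a typed (D) is REFUTED by ONE non-zero `K`-fixed block
  vector at ONE level restricting into `F¹H¹(P_Γ)` (smaller levels: pull-back along the finite level covering — injective,
  `F¹`-preserving).  This is the shape in which Stage 1's theta lane (`towerFamily … : (pinD …).H10`, `= F¹`) meets the blocks.
THE T2 REPORT: (D) — the Hodge type of `block μ` inside the tower — is NOT a consequence of the END's displayed (c)+(d) family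
{`M`, `jH`, `hjHinj`, `hjH`, `pieces`} (no type among them mentions `U.hodge`; `jH` is an abstract injective `ℂ[G]`-map; `block` is
intrinsic): it is [Liu2021, (4.2) ∕ Prop. 4.13] read at the PATH-A pin `τ' = ῑ₁`, not a tree theorem.  T2 closes MODULO a typed (D).
-/

set_option autoImplicit false
noncomputable section

namespace Summit.HodgeConjecture.CorCM.D2Bridge

open HodgeCM HodgeCM.Model
open HodgeCM.Literature.Theta HodgeCM.Literature.Theta.LiuAlbaneseModuleDatum
open Literature.AlgebraicGeometry.HodgeTheory
open Literature.NumberTheory.Automorphic.PicardCM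

variable {L : CMField} {ι₁ : L →+* ℂ} {V : HermSpace3 L ι₁}

/-! ## §1 The order algebra of (E): `span (cmClasses) ≤ P`, `res (block) ≤ Q`, `P ⊓ Q = ⊥` ⇒ `res (block^K) = 0` below a threshold -/

/-- **T2, generic form** (ORIENTATION-MEMO v1.3 §3.1 (E)): `Thm418C` + CM classes in `P K` + block restricting into `Q K` +
`Disjoint (P K) (Q K)` ⇒ below a threshold every `K`-fixed vector of the `μ`-block restricts to `0` on the identity component. [folklore] -/
theorem res_eq_zero_of_thm418C_of_disjoint (hHD : exists_isReal_hodgeModel) (hI : hodgePQ_independent_of_hodgeModel)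
    (h₁ : BallQuotientUniformised) (h₃ : CMAbelianVarietyRealised)
    (T : LiuDictionary hHD hI h₁ h₃ V) (h418 : T.Thm418C)
    (μ : T.Char) (hΦ : T.PhiMu μ)
    (P Q : ∀ Γ : Level V,
      Submodule ℂ ((picardCMUniverse hHD hI h₁ h₃).CohC ((picardCMUniverse hHD hI h₁ h₃).pms L ι₁ V Γ) 1))
    (hPQ : ∀ Γ : Level V, Disjoint (P Γ) (Q Γ))
    (hT1 : ∀ Γ : Level V, T.cmClasses Γ μ ⊆ P Γ)
    (hD : ∃ Γ₁ : Level V, ∀ Γ ≤ Γ₁, ∀ x ∈ T.block μ, x ∈ fixedBy Γ.K T.H → T.res Γ x ∈ Q Γ) :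
    ∃ Γ₀ : Level V, ∀ Γ ≤ Γ₀, ∀ x ∈ T.block μ, x ∈ fixedBy Γ.K T.H → T.res Γ x = 0 := by
  obtain ⟨K₀, hK₀⟩ := h418 μ hΦ
  obtain ⟨Γ₁, hΓ₁⟩ := hD
  refine ⟨K₀ ⊓ Γ₁, fun Γ hΓ x hx hfix => ?_⟩
  have hP : T.res Γ x ∈ P Γ :=
    (Submodule.span_le.2 (hT1 Γ)) (hK₀ Γ (hΓ.trans inf_le_left) x hx hfix)
  have hQ : T.res Γ x ∈ Q Γ := hΓ₁ Γ (hΓ.trans inf_le_right) x hx hfix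
  exact (Submodule.disjoint_def.1 (hPQ Γ)) _ hP hQ

/-! ## §2 With the universe's Hodge pieces: `P = H^{1,0}`, `Q = H^{0,1}` (disjoint by the Hodge decomposition) -/

/-- `H^{1,0}(P_Γ) ∩ H^{0,1}(P_Γ) = 0` (the Hodge decomposition of `H¹`). [cite: VoisinHodgeI2002, §6.1.3 Cor. 6.14] -/
theorem disjoint_hodgePiece_one_zero (hHD : exists_isReal_hodgeModel) (hI : hodgePQ_independent_of_hodgeModel)
    (h₁ : BallQuotientUniformised) (h₃ : CMAbelianVarietyRealised) (Γ : Level V) :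
    Disjoint (((picardCMUniverse hHD hI h₁ h₃).hodge ((picardCMUniverse hHD hI h₁ h₃).pms L ι₁ V Γ) 1).piece 1 0)
      (((picardCMUniverse hHD hI h₁ h₃).hodge ((picardCMUniverse hHD hI h₁ h₃).pms L ι₁ V Γ) 1).piece 0 1) :=
  BettiUniverse.disjoint_hodge_piece hHD
    (Var.isSmoothProjective (ballQuotientUniformisedDatum_of h₁) h₃ ((picardCMUniverse hHD hI h₁ h₃).pms L ι₁ V Γ))
    (k := 1) (p := 1) (q := 0) (p' := 0) (q' := 1) rfl rfl (by decide)

/-- **T2 with Hodge types.**  `Thm418C` + (T1) «CM classes of `μ` are of type `(1,0)`» + (D) «the `μ`-block restricts into type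
`(0,1)`» ⇒ below a threshold every `K`-fixed vector of `block μ` restricts to `0` on the identity component.
[cite: VoisinHodgeI2002, §6.1.3 Cor. 6.14] -/
theorem res_eq_zero_of_thm418C_of_hodgeTypes (hHD : exists_isReal_hodgeModel) (hI : hodgePQ_independent_of_hodgeModel)
    (h₁ : BallQuotientUniformised) (h₃ : CMAbelianVarietyRealised)
    (T : LiuDictionary hHD hI h₁ h₃ V) (h418 : T.Thm418C)
    (μ : T.Char) (hΦ : T.PhiMu μ)
    (hT1 : ∀ Γ : Level V, T.cmClasses Γ μ ⊆ ((picardCMUniverse hHD hI h₁ h₃).hodge ((picardCMUniverse hHD hI h₁ h₃).pms L ι₁ V Γ) 1).piece 1 0)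
    (hD : ∃ Γ₁ : Level V, ∀ Γ ≤ Γ₁, ∀ x ∈ T.block μ, x ∈ fixedBy Γ.K T.H →
      T.res Γ x ∈ ((picardCMUniverse hHD hI h₁ h₃).hodge ((picardCMUniverse hHD hI h₁ h₃).pms L ι₁ V Γ) 1).piece 0 1) :
    ∃ Γ₀ : Level V, ∀ Γ ≤ Γ₀, ∀ x ∈ T.block μ, x ∈ fixedBy Γ.K T.H → T.res Γ x = 0 :=
  res_eq_zero_of_thm418C_of_disjoint hHD hI h₁ h₃ T h418 μ hΦ _ _ (disjoint_hodgePiece_one_zero hHD hI h₁ h₃) hT1 hD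

/-! ## §3 Separation in the tower: a `U(V)(𝔸_f)`-stable subspace whose `K`-fixed vectors restrict to `0` below a threshold is `⊥`

TRANSPORT along the tower's own API (binder-1 lineage): every vector comes from a level (`exists_ofLevel`), the action re-indexes the
components (`act_ofLevel`, `translate_apply`), the identity-component restriction reads the component `1` (`res_apply`), and the
transition pull-backs `t_1^*` are injective (`trPull_one_injective`).  Component `h` of a level-`Γ` family is read as the identity
component of the `h`-translate at the level `(Γ ⊓ Γ₀_{h⁻¹})_h ≤ Γ₀`. -/

section Separation

open HodgeCM.Model.TowerCarrier HodgeCM.Model.TowerLevel HodgeCM.Model.TowerInjective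
open Literature.NumberTheory.Transcendental (Arapura2012_Cor_15_4_6)

/-- **Separation.**  A `ℂ`-subspace `N` of the tower `H = colim_K H¹(X_K(ℂ); ℂ)`, stable under the action of `U(V)(𝔸_f)`, all of whose
vectors coming from a level `Γ ≤ Γ₀` of the tower restrict to `0` on the identity component `P_Γ`, is `⊥`.  [folklore] -/
theorem submodule_tower_eq_bot_of_res_eq_zero (hHD : exists_isReal_hodgeModel) (hI : hodgePQ_independent_of_hodgeModel)
    (hU : BallQuotientUniformisedDatum) (h₃ : CMAbelianVarietyRealised) (hA : Arapura2012_Cor_15_4_6)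
    (N : Submodule ℂ (Tower hHD hI hU h₃ hA V))
    (hN : ∀ (g : ↥V.adelicFin) (x : Tower hHD hI hU h₃ hA V), x ∈ N → act hHD hI hU h₃ hA g x ∈ N)
    (Γ₀ : Level V)
    (h0 : ∀ (Γ : Level V) (hΓ : Γ.BelowConjThree), Γ ≤ Γ₀ → ∀ x ∈ N, x ∈ levelImage hHD hI hU h₃ hA Γ hΓ →
      TowerCarrier.res hHD hI hU h₃ hA Γ hΓ x = 0) :
    N = ⊥ := by
  rw [eq_bot_iff]
  intro x hx
  obtain ⟨Γ₁, hΓ₁, c, rfl⟩ := exists_ofLevel hHD hI hU h₃ hA x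
  -- it suffices that every component of the level-`Γ₁` family `c` vanishes
  suffices hc : ∀ h : ↥V.adelicFin, (c : Π h, W hHD hI hU h₃ Γ₁ hΓ₁ h) h = 0 by
    have hc0 : c = 0 := Subtype.ext (funext hc)
    rw [hc0, map_zero]
    exact (Submodule.mem_bot ℂ).2 rfl
  intro h
  -- the auxiliary level `Γ' := Γ₁ ⊓ (Γ₀ ⊓ Γ₁)_{h⁻¹}`, in the tower, with `Γ'_h ≤ Γ₀`
  have hΓ₀' : (Γ₀ ⊓ Γ₁).BelowConjThree := hΓ₁.of_le inf_le_right
  set Γ' : Level V := Γ₁ ⊓ (Γ₀ ⊓ Γ₁).conj h⁻¹ hΓ₀' with hΓ'def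
  have hle : Γ' ≤ Γ₁ := inf_le_left
  have hΓ' : Γ'.BelowConjThree := hΓ₁.of_le hle
  have hconj : Γ'.conj h hΓ' ≤ Γ₀ := by
    have h1 : Γ'.conj h hΓ' ≤ ((Γ₀ ⊓ Γ₁).conj h⁻¹ hΓ₀').conj h (hΓ₀'.conj h⁻¹) :=
      Level.conj_mono inf_le_right h _ hΓ'
    have h2 : ((Γ₀ ⊓ Γ₁).conj h⁻¹ hΓ₀').conj h (hΓ₀'.conj h⁻¹) = Γ₀ ⊓ Γ₁ := by
      rw [← Level.conj_mul, mul_inv_cancel, Level.conj_one]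
    exact h1.trans (h2.le.trans inf_le_left)
  -- read `x` at the level `Γ'` and translate by `h`
  set c' := restrictLevel hHD hI hU h₃ hA hle hΓ₁ hΓ' c with hc'def
  have hx' : ofLevel hHD hI hU h₃ hA Γ₁ hΓ₁ c = ofLevel hHD hI hU h₃ hA Γ' hΓ' c' :=
    (ofLevel_restrictLevel hHD hI hU h₃ hA hle hΓ₁ hΓ' c).symm
  have hact : act hHD hI hU h₃ hA h (ofLevel hHD hI hU h₃ hA Γ₁ hΓ₁ c) =
      ofLevel hHD hI hU h₃ hA (Γ'.conj h hΓ') (hΓ'.conj h) (translate hHD hI hU h₃ hA hΓ' h c') := by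
    rw [hx', act_ofLevel]
  have hmem : act hHD hI hU h₃ hA h (ofLevel hHD hI hU h₃ hA Γ₁ hΓ₁ c) ∈ N := hN h _ hx
  have hres := h0 (Γ'.conj h hΓ') (hΓ'.conj h) hconj _ hmem
    (by rw [hact]; exact ofLevel_mem_levelImage hHD hI hU h₃ hA _ _ _)
  rw [hact, res_ofLevel, TowerLevel.res_apply, translate_apply, restrictLevel_apply] at hres
  -- peel the three injective pull-backs `t_1^*`
  have h3 := (injective_iff_map_eq_zero _).1 (trPull_one_injective hHD hI hU h₃ hA _ 1) _ hres
  have h4 := (injective_iff_map_eq_zero _).1 (trPull_one_injective hHD hI hU h₃ hA _ 1) _ h3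
  have h5 := (injective_iff_map_eq_zero _).1 (trPull_one_injective hHD hI hU h₃ hA _ 1) _ h4
  have key : ∀ h₁ h₂ : ↥V.adelicFin, h₁ = h₂ → (c : Π h, W hHD hI hU h₃ Γ₁ hΓ₁ h) h₁ = 0 →
      (c : Π h, W hHD hI hU h₃ Γ₁ hΓ₁ h) h₂ = 0 := by
    rintro _ _ rfl h0; exact h0
  exact key _ _ (one_mul h) h5

end Separation

/-! ## §4 At the tower-built dictionary (`LiuDictionary.ofTower`, in particular the pinned dictionary): `block μ = ⊥` -/

section Block

open HodgeCM.Model.TowerCarrier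
open Literature.NumberTheory.Transcendental (Arapura2012_Cor_15_4_6)

/-- The `ω(t)`-isotypic image is a `ℂ[G]`-stable subspace. [folklore] -/
theorem smul_mem_oscImage {G : Type*} [Group G] {Lvl : Type*} {Kof : Lvl → Subgroup G}
    (D : HodgeCM.Literature.Theta.LiuAlbaneseModuleDatum G Kof) (t : D.Triple) (r : MonoidAlgebra ℂ G) {x : D.H}
    (hx : x ∈ D.oscImage t) : r • x ∈ D.oscImage t := by
  refine Submodule.iSup_induction (fun ψ : D.Ωt t →ₗ[MonoidAlgebra ℂ G] D.H => (LinearMap.range ψ).restrictScalars ℂ)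
    (motive := fun y => r • y ∈ D.oscImage t) hx ?_ ?_ ?_
  · rintro ψ y ⟨z, rfl⟩
    exact range_le_oscImage t ψ ⟨r • z, (ψ.map_smul r z)⟩
  · rw [smul_zero]; exact zero_mem _
  · intro y z hy hz
    rw [smul_add]; exact add_mem hy hz

/-- The `μ`-block is a `ℂ[G]`-stable subspace. [folklore] -/
theorem smul_mem_block {G : Type*} [Group G] {Lvl : Type*} {Kof : Lvl → Subgroup G}
    (D : HodgeCM.Literature.Theta.LiuAlbaneseModuleDatum G Kof) (μ : D.Char) (r : MonoidAlgebra ℂ G) {x : D.H}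
    (hx : x ∈ D.block μ) : r • x ∈ D.block μ := by
  refine Submodule.iSup_induction (fun a : D.Adm μ => D.oscImage ⟨μ, a⟩)
    (motive := fun y => r • y ∈ D.block μ) hx ?_ ?_ ?_
  · intro a y hy
    exact oscImage_le_block (D := D) ⟨μ, a⟩ (smul_mem_oscImage D ⟨μ, a⟩ r hy)
  · rw [smul_zero]; exact zero_mem _
  · intro y z hy hz
    rw [smul_add]; exact add_mem hy hz

variable (V)
variable (Char : Type) (Adm : Char → Type) (Ω : (μ : Char) → Adm μ → Type)
    [∀ μ a, AddCommGroup (Ω μ a)] [∀ μ a, Module ℂ (Ω μ a)] [∀ μ a, Module (adelicAlgebra V) (Ω μ a)]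
    [∀ μ a, IsScalarTower ℂ (adelicAlgebra V) (Ω μ a)] (PhiMu : Char → Prop) (adm : Char → LiuCMSide → Prop)

/-- At the tower-built dictionary the `K`-fixed vectors are the image of `H_K` (`TowerCarrier.fixedBy_eq_levelImage`). [folklore] -/
theorem fixedBy_ofTower_eq_levelImage (hHD : exists_isReal_hodgeModel) (hI : hodgePQ_independent_of_hodgeModel)
    (h₁ : BallQuotientUniformised) (h₃ : CMAbelianVarietyRealised) (hA : Arapura2012_Cor_15_4_6)
    (Γ : Level V) (hΓ : Γ.BelowConjThree) :
    fixedBy Γ.K (LiuDictionary.ofTower hHD hI h₁ h₃ hA V Char Adm Ω PhiMu adm).H =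
      levelImage hHD hI (ballQuotientUniformisedDatum_of h₁) h₃ hA Γ hΓ :=
  fixedBy_eq_levelImage hHD hI (ballQuotientUniformisedDatum_of h₁) h₃ hA Γ hΓ

/-- At the tower-built dictionary the block is stable under the action `act g` of `U(V)(𝔸_f)` on the tower. [folklore] -/
theorem act_mem_block_ofTower (hHD : exists_isReal_hodgeModel) (hI : hodgePQ_independent_of_hodgeModel)
    (h₁ : BallQuotientUniformised) (h₃ : CMAbelianVarietyRealised) (hA : Arapura2012_Cor_15_4_6)
    (μ : Char) (g : ↥V.adelicFin)
    (x : (LiuDictionary.ofTower hHD hI h₁ h₃ hA V Char Adm Ω PhiMu adm).H)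
    (hx : x ∈ (LiuDictionary.ofTower hHD hI h₁ h₃ hA V Char Adm Ω PhiMu adm).block μ) :
    act hHD hI (ballQuotientUniformisedDatum_of h₁) h₃ hA g x ∈
      (LiuDictionary.ofTower hHD hI h₁ h₃ hA V Char Adm Ω PhiMu adm).block μ := by
  have h' := smul_mem_block (LiuDictionary.ofTower hHD hI h₁ h₃ hA V Char Adm Ω PhiMu adm).toLiuAlbaneseModuleDatum μ
    (MonoidAlgebra.of ℂ ↥V.adelicFin g) hx
  have e : MonoidAlgebra.of ℂ ↥V.adelicFin g • x = act hHD hI (ballQuotientUniformisedDatum_of h₁) h₃ hA g x :=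
    of_smul_eq_act hHD hI (ballQuotientUniformisedDatum_of h₁) h₃ hA g x
  rw [← e]
  exact h'

/-- **Block vanishing from vanishing restrictions, at the tower-built dictionary.**  If below a threshold every `K`-fixed vector of
`block μ` restricts to `0` on the identity component, then `block μ = ⊥` (the block is `U(V)(𝔸_f)`-stable and the tower separates).
[folklore] -/
theorem block_ofTower_eq_bot_of_res_eq_zero (hHD : exists_isReal_hodgeModel) (hI : hodgePQ_independent_of_hodgeModel)
    (h₁ : BallQuotientUniformised) (h₃ : CMAbelianVarietyRealised) (hA : Arapura2012_Cor_15_4_6)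
    (μ : Char)
    (h : ∃ Γ₀ : Level V, ∀ Γ ≤ Γ₀, ∀ x ∈ (LiuDictionary.ofTower hHD hI h₁ h₃ hA V Char Adm Ω PhiMu adm).block μ,
      x ∈ fixedBy Γ.K (LiuDictionary.ofTower hHD hI h₁ h₃ hA V Char Adm Ω PhiMu adm).H →
        (LiuDictionary.ofTower hHD hI h₁ h₃ hA V Char Adm Ω PhiMu adm).res Γ x = 0) :
    (LiuDictionary.ofTower hHD hI h₁ h₃ hA V Char Adm Ω PhiMu adm).block μ = ⊥ := by
  obtain ⟨Γ₀, hΓ₀⟩ := h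
  refine submodule_tower_eq_bot_of_res_eq_zero hHD hI (ballQuotientUniformisedDatum_of h₁) h₃ hA
    ((LiuDictionary.ofTower hHD hI h₁ h₃ hA V Char Adm Ω PhiMu adm).block μ)
    (act_mem_block_ofTower V Char Adm Ω PhiMu adm hHD hI h₁ h₃ hA μ) Γ₀ ?_
  intro Γ hΓ hle x hx hlev
  have hfix : x ∈ fixedBy Γ.K (LiuDictionary.ofTower hHD hI h₁ h₃ hA V Char Adm Ω PhiMu adm).H := by
    rw [fixedBy_ofTower_eq_levelImage V Char Adm Ω PhiMu adm hHD hI h₁ h₃ hA Γ hΓ]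
    exact hlev
  have h0 := hΓ₀ Γ hle x hx hfix
  rw [LiuDictionary.ofTower_res, resTotal_of hHD hI (ballQuotientUniformisedDatum_of h₁) h₃ hA Γ hΓ] at h0
  exact h0

/-- **T2 at the tower-built dictionary: `block μ = ⊥`.**  `Thm418C` + (T1) CM classes of `μ` of type `(1,0)` + (D) the `μ`-block
restricts into type `(0,1)` ⇒ `block μ = ⊥` at every `PhiMu` character.  (ORIENTATION-MEMO v1.3 §3.1 (E), §4 T2.)
[cite: VoisinHodgeI2002, §6.1.3 Cor. 6.14] -/
theorem block_ofTower_eq_bot_of_thm418C_of_hodgeTypes (hHD : exists_isReal_hodgeModel) (hI : hodgePQ_independent_of_hodgeModel)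
    (h₁ : BallQuotientUniformised) (h₃ : CMAbelianVarietyRealised) (hA : Arapura2012_Cor_15_4_6)
    (μ : Char)
    (h418 : (LiuDictionary.ofTower hHD hI h₁ h₃ hA V Char Adm Ω PhiMu adm).Thm418C) (hΦ : PhiMu μ)
    (hT1 : ∀ Γ : Level V, (LiuDictionary.ofTower hHD hI h₁ h₃ hA V Char Adm Ω PhiMu adm).cmClasses Γ μ ⊆
      ((picardCMUniverse hHD hI h₁ h₃).hodge ((picardCMUniverse hHD hI h₁ h₃).pms L ι₁ V Γ) 1).piece 1 0)
    (hD : ∃ Γ₁ : Level V, ∀ Γ ≤ Γ₁, ∀ x ∈ (LiuDictionary.ofTower hHD hI h₁ h₃ hA V Char Adm Ω PhiMu adm).block μ,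
      x ∈ fixedBy Γ.K (LiuDictionary.ofTower hHD hI h₁ h₃ hA V Char Adm Ω PhiMu adm).H →
        (LiuDictionary.ofTower hHD hI h₁ h₃ hA V Char Adm Ω PhiMu adm).res Γ x ∈ ((picardCMUniverse hHD hI h₁ h₃).hodge ((picardCMUniverse hHD hI h₁ h₃).pms L ι₁ V Γ) 1).piece 0 1) :
    (LiuDictionary.ofTower hHD hI h₁ h₃ hA V Char Adm Ω PhiMu adm).block μ = ⊥ :=
  block_ofTower_eq_bot_of_res_eq_zero V Char Adm Ω PhiMu adm hHD hI h₁ h₃ hA μ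
    (res_eq_zero_of_thm418C_of_hodgeTypes hHD hI h₁ h₃ (LiuDictionary.ofTower hHD hI h₁ h₃ hA V Char Adm Ω PhiMu adm) h418 μ hΦ hT1 hD)

end Block

/-! ## §4b A typed (D) is refuted by ONE non-zero holomorphic `K`-fixed block vector at ONE level (the shape in which Stage 1's theta
lane — `AdelicThetaTowerClass.towerFamily`, valued in `(pinD …).H10 = F¹H¹(P_Γ)` — meets the blocks) -/

section Refute

open HodgeCM.Model.TowerCarrier
open Literature.NumberTheory.Transcendental (Arapura2012_Cor_15_4_6)

variable (V)
variable (Char : Type) (Adm : Char → Type) (Ω : (μ : Char) → Adm μ → Type)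
    [∀ μ a, AddCommGroup (Ω μ a)] [∀ μ a, Module ℂ (Ω μ a)] [∀ μ a, Module (adelicAlgebra V) (Ω μ a)]
    [∀ μ a, IsScalarTower ℂ (adelicAlgebra V) (Ω μ a)] (PhiMu : Char → Prop) (adm : Char → LiuCMSide → Prop)

/-- **(D) IS REFUTED BY ONE HOLOMORPHIC VECTOR.**  At the tower-built dictionary: if ONE `K`-fixed vector of `block μ` at ONE tower
level `Γ` restricts on `P_Γ` to a NON-ZERO class in `F¹H¹(P_Γ)` (e.g. a theta class of Stage 1's `towerFamily`, typed in
`(pinD …).H10 = F¹`), then the typed (D) «below some threshold every `K`-fixed block vector restricts into `H^{0,1}`» is FALSE: the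
restriction to the smaller level `Γ ⊓ Γ₁` is the pull-back along the finite level covering — injective
(`pull_baseChange_levelCover_injective`) and `F¹`-preserving (`pull_hodge`) — and `F¹ ∩ H^{0,1} = 0` (`F¹` and `conj F¹` are `1`-opposed).
[cite: VoisinHodgeI2002, §7.3.2] [cite: HatcherAT2002, §3.G Prop. 3G.1] -/
theorem not_block_res_subset_piece_zero_one_of_res_mem_F_one
    (hHD : exists_isReal_hodgeModel) (hI : hodgePQ_independent_of_hodgeModel)
    (h₁ : BallQuotientUniformised) (h₃ : CMAbelianVarietyRealised) (hA : Arapura2012_Cor_15_4_6) (μ : Char)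
    (Γ : Level V) (hΓ : Γ.BelowConjThree) (x : (LiuDictionary.ofTower hHD hI h₁ h₃ hA V Char Adm Ω PhiMu adm).H)
    (hx : x ∈ (LiuDictionary.ofTower hHD hI h₁ h₃ hA V Char Adm Ω PhiMu adm).block μ)
    (hfix : x ∈ fixedBy Γ.K (LiuDictionary.ofTower hHD hI h₁ h₃ hA V Char Adm Ω PhiMu adm).H)
    (hF : (LiuDictionary.ofTower hHD hI h₁ h₃ hA V Char Adm Ω PhiMu adm).res Γ x ∈
      ((picardCMUniverse hHD hI h₁ h₃).hodge ((picardCMUniverse hHD hI h₁ h₃).pms L ι₁ V Γ) 1).F 1)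
    (hne : (LiuDictionary.ofTower hHD hI h₁ h₃ hA V Char Adm Ω PhiMu adm).res Γ x ≠ 0) :
    ¬ ∃ Γ₁ : Level V, ∀ Γ' ≤ Γ₁, ∀ y ∈ (LiuDictionary.ofTower hHD hI h₁ h₃ hA V Char Adm Ω PhiMu adm).block μ,
      y ∈ fixedBy Γ'.K (LiuDictionary.ofTower hHD hI h₁ h₃ hA V Char Adm Ω PhiMu adm).H →
        (LiuDictionary.ofTower hHD hI h₁ h₃ hA V Char Adm Ω PhiMu adm).res Γ' y ∈
          ((picardCMUniverse hHD hI h₁ h₃).hodge ((picardCMUniverse hHD hI h₁ h₃).pms L ι₁ V Γ') 1).piece 0 1 := by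
  rintro ⟨Γ₁, hD⟩
  -- the common level `Γ ⊓ Γ₁`
  have hle : Γ ⊓ Γ₁ ≤ Γ := inf_le_left
  have hΓ' : (Γ ⊓ Γ₁).BelowConjThree := hΓ.of_le hle
  -- `x` comes from the level `Γ`
  have hlev : x ∈ levelImage hHD hI (ballQuotientUniformisedDatum_of h₁) h₃ hA Γ hΓ := by
    rw [← fixedBy_ofTower_eq_levelImage V Char Adm Ω PhiMu adm hHD hI h₁ h₃ hA Γ hΓ]; exact hfix
  obtain ⟨c, rfl⟩ := hlev
  have hfix' : ofLevel hHD hI (ballQuotientUniformisedDatum_of h₁) h₃ hA Γ hΓ c ∈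
      fixedBy (Γ ⊓ Γ₁).K (LiuDictionary.ofTower hHD hI h₁ h₃ hA V Char Adm Ω PhiMu adm).H := by
    rw [fixedBy_ofTower_eq_levelImage V Char Adm Ω PhiMu adm hHD hI h₁ h₃ hA (Γ ⊓ Γ₁) hΓ']
    exact levelImage_mono hHD hI (ballQuotientUniformisedDatum_of h₁) h₃ hA hle hΓ hΓ'
      (ofLevel_mem_levelImage hHD hI (ballQuotientUniformisedDatum_of h₁) h₃ hA Γ hΓ c)
  have h01 := hD (Γ ⊓ Γ₁) inf_le_right _ hx hfix'
  -- read the dictionary's `res` on the tower: at `Γ ⊓ Γ₁` it is the pull-back along the level covering of the value at `Γ`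
  have key : (LiuDictionary.ofTower hHD hI h₁ h₃ hA V Char Adm Ω PhiMu adm).res (Γ ⊓ Γ₁)
        (ofLevel hHD hI (ballQuotientUniformisedDatum_of h₁) h₃ hA Γ hΓ c) =
      (BettiUniverse.pull (levelCover (ballQuotientUniformisedDatum_of h₁) h₃ hHD hA Γ (Γ ⊓ Γ₁) (Level.Γ_mono hle)) 1).baseChange ℂ
        ((LiuDictionary.ofTower hHD hI h₁ h₃ hA V Char Adm Ω PhiMu adm).res Γ
          (ofLevel hHD hI (ballQuotientUniformisedDatum_of h₁) h₃ hA Γ hΓ c)) := by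
    show resTotal hHD hI (ballQuotientUniformisedDatum_of h₁) h₃ hA (Γ ⊓ Γ₁)
          (ofLevel hHD hI (ballQuotientUniformisedDatum_of h₁) h₃ hA Γ hΓ c) =
        (BettiUniverse.pull (levelCover (ballQuotientUniformisedDatum_of h₁) h₃ hHD hA Γ (Γ ⊓ Γ₁) (Level.Γ_mono hle)) 1).baseChange ℂ
          (resTotal hHD hI (ballQuotientUniformisedDatum_of h₁) h₃ hA Γ
            (ofLevel hHD hI (ballQuotientUniformisedDatum_of h₁) h₃ hA Γ hΓ c))
    rw [resTotal_of hHD hI (ballQuotientUniformisedDatum_of h₁) h₃ hA (Γ ⊓ Γ₁) hΓ',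
      resTotal_of hHD hI (ballQuotientUniformisedDatum_of h₁) h₃ hA Γ hΓ,
      res_ofLevel_of_le hHD hI (ballQuotientUniformisedDatum_of h₁) h₃ hA hle hΓ hΓ' c]
    rfl
  rw [key] at h01
  set y := (LiuDictionary.ofTower hHD hI h₁ h₃ hA V Char Adm Ω PhiMu adm).res Γ
    (ofLevel hHD hI (ballQuotientUniformisedDatum_of h₁) h₃ hA Γ hΓ c) with hy
  -- its pull-back is non-zero and in `F¹`
  have hne' : (BettiUniverse.pull (levelCover (ballQuotientUniformisedDatum_of h₁) h₃ hHD hA Γ (Γ ⊓ Γ₁) (Level.Γ_mono hle)) 1).baseChange ℂ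
      y ≠ 0 := by
    intro h0
    apply hne
    exact LevelPullInjective.pull_baseChange_levelCover_injective hHD (ballQuotientUniformisedDatum_of h₁) h₃ hA
      (Level.Γ_mono hle) 1 (h0.trans (map_zero _).symm)
  have hF' : (BettiUniverse.pull (levelCover (ballQuotientUniformisedDatum_of h₁) h₃ hHD hA Γ (Γ ⊓ Γ₁) (Level.Γ_mono hle)) 1).baseChange ℂ
      y ∈ ((picardCMUniverse hHD hI h₁ h₃).hodge ((picardCMUniverse hHD hI h₁ h₃).pms L ι₁ V (Γ ⊓ Γ₁)) 1).F 1 :=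
    BettiUniverse.pull_hodge hHD hI
      (Var.isSmoothProjective (ballQuotientUniformisedDatum_of h₁) h₃ ((picardCMUniverse hHD hI h₁ h₃).pms L ι₁ V (Γ ⊓ Γ₁)))
      (Var.isSmoothProjective (ballQuotientUniformisedDatum_of h₁) h₃ ((picardCMUniverse hHD hI h₁ h₃).pms L ι₁ V Γ))
      _ 1 1 (Submodule.mem_map_of_mem hF)
  -- `F¹ ∩ H^{0,1} = 0`
  have hdisj : Disjoint
      (((picardCMUniverse hHD hI h₁ h₃).hodge ((picardCMUniverse hHD hI h₁ h₃).pms L ι₁ V (Γ ⊓ Γ₁)) 1).F 1)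
      (((picardCMUniverse hHD hI h₁ h₃).hodge ((picardCMUniverse hHD hI h₁ h₃).pms L ι₁ V (Γ ⊓ Γ₁)) 1).piece 0 1) :=
    ((((picardCMUniverse hHD hI h₁ h₃).hodge ((picardCMUniverse hHD hI h₁ h₃).pms L ι₁ V (Γ ⊓ Γ₁)) 1).isCompl_F_complexConj
      1 1 (by norm_num)).disjoint).mono_right (Literature.AlgebraicGeometry.Motives.HodgeStructure.piece_le_complexConj_F _ 0 1)
  exact hne' ((Submodule.disjoint_def.1 hdisj) _ hF' h01)

end Refute

/-! ## §5 At THE PINNED DICTIONARY of the END (`liuDictionaryPin … V I line`, `PhiMu i = PhiMuLine ι₁ (line i)`,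
`adm i d = d.IsReflexOfTypeG ι₁ (typeOfLine (line i))`) -/

section Pin

open Literature.NumberTheory.Transcendental (Arapura2012_Cor_15_4_6)

variable (V) (I : Type) (line : I → SplitLineE V)

/-- **T2 AT THE LITERAL PIN.**  For the pinned dictionary `𝔇 := liuDictionaryPin … V I line` of the END and an index line `i` with
`PhiMuLine ι₁ (line i)` (`ι₁ ∈ Φ^δ(a_i)`): `𝔇.Thm418C` (what the displayed (c)+(d) family of `PinSignatures.thm418C_liuDictionaryPin_of_pins`
yields) + (T1) «the CM classes `𝔇.cmClasses Γ i` are of type `(1,0)`» + (D) «`𝔇.block i` restricts into type `(0,1)`» ⇒ `𝔇.block i = ⊥`.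
(T1) is own-crow's `tau_mem_cmType_of_isReflexOfType` + `IsCMTypeRealisation` + `pull_hodge` (wb-6 ∕ wb-7); (D) is [Liu2021, (4.2) ∕ Prop. 4.13]
read at the PATH-A pin `τ' = ῑ₁` — NOT a tree theorem and NOT a consequence of the displayed family. [cite: VoisinHodgeI2002, §6.1.3 Cor. 6.14] -/
theorem block_pin_eq_bot_of_thm418C_of_hodgeTypes (hHD : exists_isReal_hodgeModel) (hI : hodgePQ_independent_of_hodgeModel)
    (h₁ : BallQuotientUniformised) (h₃ : CMAbelianVarietyRealised) (hA : Arapura2012_Cor_15_4_6)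
    (i : I)
    (h418 : (liuDictionaryPin hHD hI h₁ h₃ hA V I line).Thm418C) (hΦ : SplitLine.PhiMuLine ι₁ (line i))
    (hT1 : ∀ Γ : Level V, (liuDictionaryPin hHD hI h₁ h₃ hA V I line).cmClasses Γ i ⊆ ((picardCMUniverse hHD hI h₁ h₃).hodge ((picardCMUniverse hHD hI h₁ h₃).pms L ι₁ V Γ) 1).piece 1 0)
    (hD : ∃ Γ₁ : Level V, ∀ Γ ≤ Γ₁, ∀ x ∈ (liuDictionaryPin hHD hI h₁ h₃ hA V I line).block i,
      x ∈ fixedBy Γ.K (liuDictionaryPin hHD hI h₁ h₃ hA V I line).H →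
        (liuDictionaryPin hHD hI h₁ h₃ hA V I line).res Γ x ∈ ((picardCMUniverse hHD hI h₁ h₃).hodge ((picardCMUniverse hHD hI h₁ h₃).pms L ι₁ V Γ) 1).piece 0 1) :
    (liuDictionaryPin hHD hI h₁ h₃ hA V I line).block i = ⊥ :=
  block_ofTower_eq_bot_of_thm418C_of_hodgeTypes V I _ _ _ _ hHD hI h₁ h₃ hA i h418 hΦ hT1 hD

/-- **T2 AT THE LITERAL PIN, inconsistency form**: with a non-zero block at a `PhiMu` line, `Thm418C` ∧ (T1) ∧ (D) is contradictory.
[cite: VoisinHodgeI2002, §6.1.3 Cor. 6.14] -/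
theorem false_of_thm418C_pin_of_hodgeTypes_of_block_ne_bot (hHD : exists_isReal_hodgeModel) (hI : hodgePQ_independent_of_hodgeModel)
    (h₁ : BallQuotientUniformised) (h₃ : CMAbelianVarietyRealised) (hA : Arapura2012_Cor_15_4_6)
    (i : I)
    (h418 : (liuDictionaryPin hHD hI h₁ h₃ hA V I line).Thm418C) (hΦ : SplitLine.PhiMuLine ι₁ (line i))
    (hT1 : ∀ Γ : Level V, (liuDictionaryPin hHD hI h₁ h₃ hA V I line).cmClasses Γ i ⊆ ((picardCMUniverse hHD hI h₁ h₃).hodge ((picardCMUniverse hHD hI h₁ h₃).pms L ι₁ V Γ) 1).piece 1 0)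
    (hD : ∃ Γ₁ : Level V, ∀ Γ ≤ Γ₁, ∀ x ∈ (liuDictionaryPin hHD hI h₁ h₃ hA V I line).block i,
      x ∈ fixedBy Γ.K (liuDictionaryPin hHD hI h₁ h₃ hA V I line).H →
        (liuDictionaryPin hHD hI h₁ h₃ hA V I line).res Γ x ∈ ((picardCMUniverse hHD hI h₁ h₃).hodge ((picardCMUniverse hHD hI h₁ h₃).pms L ι₁ V Γ) 1).piece 0 1)
    (hne : (liuDictionaryPin hHD hI h₁ h₃ hA V I line).block i ≠ ⊥) : False :=
  hne (block_pin_eq_bot_of_thm418C_of_hodgeTypes V I line hHD hI h₁ h₃ hA i h418 hΦ hT1 hD)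

/-- **AT THE LITERAL PIN: a typed (D) is refuted by ONE non-zero holomorphic `K`-fixed vector of `block i` at ONE tower level.**
[cite: VoisinHodgeI2002, §7.3.2] [cite: HatcherAT2002, §3.G Prop. 3G.1] -/
theorem not_block_pin_res_subset_piece_zero_one_of_res_mem_F_one
    (hHD : exists_isReal_hodgeModel) (hI : hodgePQ_independent_of_hodgeModel)
    (h₁ : BallQuotientUniformised) (h₃ : CMAbelianVarietyRealised) (hA : Arapura2012_Cor_15_4_6) (i : I)
    (Γ : Level V) (hΓ : Γ.BelowConjThree) (x : (liuDictionaryPin hHD hI h₁ h₃ hA V I line).H)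
    (hx : x ∈ (liuDictionaryPin hHD hI h₁ h₃ hA V I line).block i)
    (hfix : x ∈ fixedBy Γ.K (liuDictionaryPin hHD hI h₁ h₃ hA V I line).H)
    (hF : (liuDictionaryPin hHD hI h₁ h₃ hA V I line).res Γ x ∈
      ((picardCMUniverse hHD hI h₁ h₃).hodge ((picardCMUniverse hHD hI h₁ h₃).pms L ι₁ V Γ) 1).F 1)
    (hne : (liuDictionaryPin hHD hI h₁ h₃ hA V I line).res Γ x ≠ 0) :
    ¬ ∃ Γ₁ : Level V, ∀ Γ' ≤ Γ₁, ∀ y ∈ (liuDictionaryPin hHD hI h₁ h₃ hA V I line).block i,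
      y ∈ fixedBy Γ'.K (liuDictionaryPin hHD hI h₁ h₃ hA V I line).H →
        (liuDictionaryPin hHD hI h₁ h₃ hA V I line).res Γ' y ∈
          ((picardCMUniverse hHD hI h₁ h₃).hodge ((picardCMUniverse hHD hI h₁ h₃).pms L ι₁ V Γ') 1).piece 0 1 :=
  not_block_res_subset_piece_zero_one_of_res_mem_F_one V I _ _ _ _ hHD hI h₁ h₃ hA i Γ hΓ x hx hfix hF hne

end Pin

end Summit.HodgeConjecture.CorCM.D2Bridge

end
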